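import Mathlib
import HarnessLib
import Literature.Analysis.FluidPDE.SelfSimilar
import Literature.Analysis.FluidPDE.AxisymmetricEuler
import Literature.Analysis.FluidPDE.OseenMildUniqueness
import Literature.Analysis.FluidPDE.KNSSRemark61
import Literature.Analysis.UnboundedOperators.HeatKernelBoundedData
import Literature.Analysis.FluidPDE.OseenZoomCovariance
import Literature.Analysis.FluidPDE.KNSSOseenMildDecayTools
import Literature.Analysis.FluidPDE.KNSSRegularityGalileanProofs
import Literature.Analysis.FluidPDE.BoundedWeakIsometry
import Literature.Analysis.FluidPDE.KNSSLineInvariantLiouville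
import Literature.Analysis.FluidPDE.OseenHeatKernelBridge
import Literature.Analysis.FluidPDE.AlbrittonKatoClassIntegralForm
import Literature.Analysis.FluidPDE.BoundedWeakDriftLimit
import Literature.Analysis.FluidPDE.AncientLPSLiouvilleMild
import Summits.NavierStokesRegularity.NavierStokesRegularity.Theorems.HardyPointSinkHardyAncientLimitMild
import Summits.NavierStokesRegularity.NavierStokesRegularity.Theorems.ScenarioCensusAncientSymmetry
import Summits.NavierStokesRegularity.NavierStokesRegularity.Theorems.TypeILiouvilleTypeIliouvilleLOseenGauge
import Summits.NavierStokesRegularity.NavierStokesRegularity.Theorems.ScenarioCensusPitchDefectGauge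
import Summits.NavierStokesRegularity.NavierStokesRegularity.Theorems.ScenarioCensusPitchDefectGaugeTools

/-!
# Screw Oseen gauge — part 1/4: the honest class, the obligations, O1 · O2 · O3a · directional Liouville

Re-homed for the census (typer seat; lead ORDER 2026-08-28) from ns-idea-3's merged landable module
`ScenarioCensusScrewGauge.lean` (D-0145 ideator seat, files-only; sha16 27b7018076f2c110, 1160 lines, rc 0, 0 sorry, standard
axioms; supersedes `ScenarioCensusRowA8HonestCell.lean` 039d2be67bc0fcfb) in FOUR files for the 400-line rule:
`ScenarioCensusRowA8HonestGauge` → `ScenarioCensusRowA8HonestBoost` → `ScenarioCensusRowA8HonestCell` → `ScenarioCensusRowA5HonestCell`.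
Mathematics and Lean text are the ideator's verbatim in namespace `…ScenarioCensus.RowA8HonestCell` (cell A5gen in
`…ScenarioCensus.RowA5HonestCell`); only docstrings were added and duplicate rotation helpers made `private`.
«PROVED below» in §1 refers to the four files together.

Two cell identifications, standard axioms, no `sorry`:
* `row_A8_iff_row_A8gen : ScenarioCensus.Row_A8 ↔ Row_A8gen` — row A8 (bounded ancient mild, DUALITY class,
  measurable slices, screw-symmetric of pitch `h ≠ 0` about the `x₃`-axis ⇒ a.e.-constant slices) ≡ its honest
  cell: a GENUINE bounded continuous Oseen-mild field on `(−∞,T)` (`IsGenuine T w`) EXACTLY screw-symmetric of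
  pitch `h ≠ 0` about the FIXED `x₃`-axis has constant slices;
* `axisymmetricLiouvilleBoundedSwirl_iff_row_A5gen : AxisymmetricLiouvilleBoundedSwirl ↔ Row_A5gen` — the canonical
  KNSS §5 bounded-swirl leaf (= census row A5: duality class, pointwise axisymmetric slices, `|Γ| ≤ C`) ≡ its
  honest cell: a genuine field EXACTLY axisymmetric about the fixed axis with bounded swirl has constant slices.
So the duality-class packaging of these rows (a.e. slices with symmetry imposed on junk values, the parasitic
Galilean gauge `x ↦ x − A(t)`, `+ c(t)` of `Theorems.oseen_gauge_of_aestronglyMeasurable`, the resulting TWISTED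
symmetry about a MOVING axis) carries no content.

Mechanism (any pitch `h`; NO Type-I rate, NO smallness): O1 screw Oseen gauge `helicalOseenGauge_holds` (tree
gauge + `PitchDefect.helical_transfer`); O2 twist rigidity `twistRigidity_holds` (momentum conservation);
O3a/O5 isometry and Galilean-boost covariance of the honest class (tree heat/Oseen kernels,
`IsKNSSDriftMild.galileanCovariance_R3`); O3b′ THE LEVER `galileanDefectPeriod_holds` («Galilean-defect period»:
if `v` and `v(· + ε τ) + k` are both genuine, `ε τ₂ − ε τ₁ + (τ₂ − τ₁)k` is a period of `v τ₂` — honest boost +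
forward uniqueness `FluidPDE.oseenMild_bounded_unique`); seam `axisDichotomy_of_period` (chords of the period
circle `{Δ − R_{−θ}Δ}` span the horizontal plane unless `Δ_h = 0`: every slice a SHEAR, or the axis moves
UNIFORMLY with velocity `c_h`); shear branch by ONE direction of invariance (tree KNSS Thm 5.1
`FluidPDE.apply_eq_apply_zero_of_invariant_along`); uniform branch: the honest boost by `c_h` kills the twist
identically ⇒ exact symmetry about the fixed axis; at pitch 0 the swirl bound is transported through the gauge
(`swirl_bound_transport`); F forward rigidity; converses by `HardyAncientLimit.isBoundedAncientMildSolution_of_oseen`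
+ continuity + time shift.

Provenance: ns-idea-3 (D-0145 ideator seat, files-only) LINE 5 «honest-gauge» rev 4 (critic idea-crit-3: PASS) and
LINE 6 «honest-swirl» rev 1; this is the pruned, landable, merged form.  No census value changes (A8, A8gen, A5,
A5gen all OPEN — each row is now ONE statement with its cell).  NS regularity is NOT proved; no summit statement
is proved by this file.
-/

noncomputable section

open MeasureTheory Set Filter Topology Function Metric
open scoped ENNReal NNReal

set_option linter.dupNamespace false

namespace Summit.NavierStokesRegularity.NavierStokesRegularity.Theorems.ScenarioCensus.RowA8HonestCell

open Literature.Analysis Literature.Analysis.FluidPDE Literature.Analysis.UnboundedOperators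
open Summit.NavierStokesRegularity.NavierStokesRegularity.Theorems.ScenarioCensus (Row_A8)
open Summit.NavierStokesRegularity.NavierStokesRegularity.Theorems.ScenarioCensus.PitchDefect
  (helical_transfer twist_eq_twist_of_tendsto tendsto_setAverage_sub_of_oseenMild)

/-- Euclidean `ℝ³` as `EuclideanSpace ℝ (Fin 3)`. -/
abbrev E3 : Type := EuclideanSpace ℝ (Fin 3)

/-- the axis direction `e₃`. -/
abbrev e3 : E3 := EuclideanSpace.single 2 (1 : ℝ)

/-- horizontal part of a vector: `hor d = d − d₃ e₃`. -/
def hor (d : E3) : E3 := d - (d 2) • e3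

/-! ## §0  The honest class -/

/-- **Genuine bounded continuous Oseen-mild field on `(−∞,T)`** — exactly the clauses exported by
the tree's gauge theorem `Theorems.oseen_gauge_of_aestronglyMeasurable` (there with `T = 0`):
jointly measurable, continuous on `(−∞,T) × ℝ³`, uniformly bounded, weakly divergence-free
slices, and the pointwise Oseen/Duhamel representation between any two times. -/
def IsGenuine (T : ℝ) (v : ℝ → E3 → E3) : Prop :=
  Measurable (uncurry v) ∧ ContinuousOn (uncurry v) (Iio T ×ˢ univ) ∧
    (∃ K : ℝ, ∀ t < T, ∀ x, ‖v t x‖ ≤ K) ∧ (∀ t < T, FluidPDE.IsWeaklyDivFree (v t)) ∧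
      ∀ s t : ℝ, s < t → t < T → ∀ x,
        v t x = UnboundedOperators.heatExtension (v s) (t - s) x - FluidPDE.oseenDuhamel 1 s v v t x

/-- The honest class is monotone in the end time: genuine on `(−∞,T)` gives genuine on `(−∞,T')`
for `T' ≤ T`. -/
theorem IsGenuine.mono {T T' : ℝ} {v : ℝ → E3 → E3} (hv : IsGenuine T v) (hT : T' ≤ T) :
    IsGenuine T' v := by
  obtain ⟨hm, hc, ⟨K, hK⟩, hdiv, hmild⟩ := hv
  refine ⟨hm, hc.mono (prod_mono (Iio_subset_Iio hT) subset_rfl), ⟨K, fun t ht => hK t (ht.trans_le hT)⟩,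
    fun t ht => hdiv t (ht.trans_le hT), fun s t hst ht => hmild s t hst (ht.trans_le hT)⟩

/-- Every slice `v t`, `t < T`, of a genuine field is continuous. -/
theorem IsGenuine.continuous_slice {T : ℝ} {v : ℝ → E3 → E3} (hv : IsGenuine T v) {t : ℝ}
    (ht : t < T) : Continuous (v t) :=
  hv.2.1.comp_continuous (Continuous.prodMk_right t) fun y => ⟨ht, mem_univ y⟩

/-! ## §1  Obligations -/

/-- **O1 (support, PROVED below).** Screw Oseen gauge, ANY pitch `h` (pitch `0` = axisymmetry): the genuine
representative of a duality-class screw-symmetric solution, its frame `A`, gauge `c`, and the TWISTED screw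
symmetry of every slice. -/
def HelicalOseenGauge : Prop :=
  ∀ (h : ℝ) (u : ℝ → E3 → E3),
    FluidPDE.IsBoundedAncientMildSolution 1 u → (∀ t < 0, AEStronglyMeasurable (u t) volume) →
      (∀ t < 0, ∀ (θ : ℝ) (x : E3), u t (rotZ θ x + (h * θ) • e3) = rotZ θ (u t x)) →
        ∃ (v : ℝ → E3 → E3) (A c : ℝ → E3), IsGenuine 0 v ∧ Continuous A ∧
          (∀ t < 0, u t =ᵐ[volume] fun x => v t (x - A t) + c t) ∧
          ∀ t < 0, ∀ (θ : ℝ) (y : E3),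
            v t (rotZ θ y + (rotZ θ (A t) - A t + (h * θ) • e3)) = rotZ θ (v t y) + (rotZ θ (c t) - c t)

/-- **O2 (support, PROVED below).** Twist rigidity: the twist `R_θ c(t) − c(t)` of the genuine
representative is time-independent (momentum conservation between two slices; no rate). -/
def TwistRigidity : Prop :=
  ∀ (h : ℝ) (v : ℝ → E3 → E3) (A c : ℝ → E3), IsGenuine 0 v →
    (∀ t < 0, ∀ (θ : ℝ) (y : E3),
        v t (rotZ θ y + (rotZ θ (A t) - A t + (h * θ) • e3)) = rotZ θ (v t y) + (rotZ θ (c t) - c t)) →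
      ∀ s < 0, ∀ t < 0, ∀ θ : ℝ, rotZ θ (c t) - c t = rotZ θ (c s) - c s

/-- **O3 (support, PROVED below: `axisDichotomy_holds` — the new lever).** Axis dichotomy for a genuine field with a twisted
screw symmetry of constant twist about the moving axis `−A_h(t)`: either every slice is a shear
(invariant under all horizontal translations), or on some backward end the axis moves uniformly
with velocity `c_h`.  Proved below from O3a + O3b′: `axisDichotomy_of_period : IsometryCovariance → GalileanDefectPeriod → AxisDichotomy`
(see the two Props below; the linear-algebra seam «period lines for two angles span the
horizontal plane» is routine). -/
def AxisDichotomy : Prop :=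
  ∀ (h : ℝ) (v : ℝ → E3 → E3) (A : ℝ → E3) (cbar : E3), IsGenuine 0 v → Continuous A →
    (∀ t < 0, ∀ (θ : ℝ) (y : E3),
        v t (rotZ θ y + (rotZ θ (A t) - A t + (h * θ) • e3)) = rotZ θ (v t y) + (rotZ θ cbar - cbar)) →
      (∀ τ < 0, ∀ d : E3, d 2 = 0 → ∀ y, v τ (y + d) = v τ y) ∨
        ∃ τ₂ < 0, ∀ τ ≤ τ₂, hor (A τ) = hor (A τ₂) + (τ - τ₂) • hor cbar

/-- **O3a (sub-lemma of O3, PROVED below: `isometryCovariance_holds`).** Isometry covariance of the honest class under a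
fixed screw isometry `y ↦ R_θ y + D`. -/
def IsometryCovariance : Prop :=
  ∀ (T : ℝ) (v : ℝ → E3 → E3) (θ : ℝ) (D : E3), IsGenuine T v →
    IsGenuine T fun τ y => rotZ (-θ) (v τ (rotZ θ y + D))

/-- **O3b′ (support, PROVED below: `galileanDefectPeriod_holds`).** The Galilean-defect PERIOD lemma,
with no continuity hypothesis on `ε` and no line upgrade: if `v` and `W τ y = v τ (y + ε τ) + k` are both
genuine on `(−∞,T)`, then for `τ₁ < τ₂ < T` the Galilean defect `ε τ₂ − ε τ₁ + (τ₂ − τ₁)k` is a period of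
the slice `v τ₂` (honest boost matching `W` at `τ₁` + forward uniqueness of bounded Oseen-mild fields).
The seam `axisDichotomy_of_period` needs only this (chord trick: the periods `Δ − R_{−θ}Δ`, `θ ∈ ℝ`,
already generate the horizontal plane). -/
def GalileanDefectPeriod : Prop :=
  ∀ (T : ℝ) (v : ℝ → E3 → E3) (ε : ℝ → E3) (k : E3), IsGenuine T v →
    (∃ W : ℝ → E3 → E3, IsGenuine T W ∧ ∀ τ < T, ∀ y, W τ y = v τ (y + ε τ) + k) →
      ∀ τ₁ τ₂ : ℝ, τ₁ < τ₂ → τ₂ < T → ∀ y : E3,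
        v τ₂ (y + (ε τ₂ - ε τ₁ + (τ₂ - τ₁) • k)) = v τ₂ y

/-- **O5 (support, PROVED below: `galileanBoost_holds`).** Honest Galilean boosts (constant velocity `k`, constant
offset `α`) preserve the honest class on `(−∞,0)`. -/
def GalileanBoost : Prop :=
  ∀ (v : ℝ → E3 → E3) (α k : E3), IsGenuine 0 v → IsGenuine 0 fun τ y => v τ (y - α - τ • k) + k

/-- **Census cell A8gen (OPEN; ≡ row A8 by `row_A8_iff_row_A8gen`).** A genuine bounded continuous Oseen-mild
field on `(−∞,T)`, EXACTLY screw-symmetric of pitch `h ≠ 0` about the FIXED `x₃`-axis, has constant slices. -/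
def Row_A8gen : Prop :=
  ∀ h : ℝ, h ≠ 0 → ∀ (T : ℝ) (w : ℝ → E3 → E3), IsGenuine T w →
    (∀ τ < T, ∀ (θ : ℝ) (y : E3), w τ (rotZ θ y + (h * θ) • e3) = rotZ θ (w τ y)) →
      ∀ τ < T, ∀ y, w τ y = w τ 0

/-- **F (support, PROVED below).** Forward rigidity: a.e.-constant slices on a backward end propagate to all `t < 0`. -/
def ForwardRigidity : Prop :=
  ∀ u : ℝ → E3 → E3, FluidPDE.IsBoundedAncientMildSolution 1 u →
    (∀ t < 0, AEStronglyMeasurable (u t) volume) →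
      ∀ t₀ : ℝ, t₀ < 0 → (∀ s : ℝ, s < t₀ → ∃ b : E3, u s =ᵐ[volume] fun _ => b) →
        ∀ t < 0, ∃ b : E3, u t =ᵐ[volume] fun _ => b

/-! ## §3  O1 and O2 are theorems (tree gauge + momentum conservation) -/

/-- **O1 is a theorem** (any pitch): the tree's gauge theorem `Theorems.oseen_gauge_of_aestronglyMeasurable`
plus `PitchDefect.helical_transfer` give the genuine representative `(v, A, c)` of a duality-class
screw-symmetric solution with its twisted screw symmetry. -/
theorem helicalOseenGauge_holds : HelicalOseenGauge := by
  intro h u hu hmeas hsym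
  obtain ⟨v, A, c, hvm, hvc, hK, hdiv, hvmild, hA, hrep⟩ :=
    Summit.NavierStokesRegularity.NavierStokesRegularity.Theorems.oseen_gauge_of_aestronglyMeasurable
      u hu hmeas
  have hgen : IsGenuine 0 v := ⟨hvm, hvc, hK, hdiv, hvmild⟩
  refine ⟨v, A, c, hgen, hA, hrep, ?_⟩
  intro t ht θ y
  exact helical_transfer (hgen.continuous_slice ht) (hsym t ht θ) (hrep t ht) y

/-- **O2 is a theorem**: the twist `R_θ c(t) − c(t)` of the genuine representative is time independent
(momentum conservation: `PitchDefect.tendsto_setAverage_sub_of_oseenMild`, `twist_eq_twist_of_tendsto`). -/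
theorem twistRigidity_holds : TwistRigidity := by
  intro h v A c hgen hsymv s hs t ht θ
  obtain ⟨hvm, hvc, ⟨K, hK⟩, hdiv, hvmild⟩ := hgen
  have hgen' : IsGenuine 0 v := ⟨hvm, hvc, ⟨K, hK⟩, hdiv, hvmild⟩
  rcases lt_trichotomy s t with hst | rfl | hts
  · exact twist_eq_twist_of_tendsto (hgen'.continuous_slice ht) (hgen'.continuous_slice hs)
      (hK t ht) (hK s hs) (hsymv t ht θ) (hsymv s hs θ)
      (tendsto_setAverage_sub_of_oseenMild hvm hK hvmild hst ht)
  · rfl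
  · exact (twist_eq_twist_of_tendsto (hgen'.continuous_slice hs) (hgen'.continuous_slice ht)
      (hK s hs) (hK t ht) (hsymv s hs θ) (hsymv t ht θ)
      (tendsto_setAverage_sub_of_oseenMild hvm hK hvmild hts hs)).symm

/-! ## §3c  O3a is a theorem (translation and isometry covariance of the honest class; tree kernels) -/

/-- Space translation `y ↦ y + D` preserves the honest class (tree kernels
`heatExtension_comp_add_right_apply`, `oseenDuhamel_comp_add_right`). -/
theorem IsGenuine.comp_add_right {T : ℝ} {v : ℝ → E3 → E3} (hv : IsGenuine T v) (D : E3) :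
    IsGenuine T fun τ y => v τ (y + D) := by
  obtain ⟨hm, hc, ⟨K, hK⟩, hdiv, hmild⟩ := hv
  refine ⟨?_, ?_, ⟨K, fun t ht x => hK t ht (x + D)⟩, fun t ht => (hdiv t ht).comp_add_right' D, ?_⟩
  · have e : uncurry (fun τ y => v τ (y + D)) = uncurry v ∘ fun p : ℝ × E3 => (p.1, p.2 + D) := by
      funext p; rfl
    rw [e]
    exact hm.comp (measurable_fst.prodMk (measurable_snd.add measurable_const))
  · have e : uncurry (fun τ y => v τ (y + D)) = uncurry v ∘ fun p : ℝ × E3 => (p.1, p.2 + D) := by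
      funext p; rfl
    rw [e]
    refine hc.comp (continuous_fst.prodMk (continuous_snd.add continuous_const)).continuousOn ?_
    intro p hp
    exact ⟨hp.1, mem_univ _⟩
  · intro s t hst htT x
    show v t (x + D) = UnboundedOperators.heatExtension (fun y => v s (y + D)) (t - s) x -
      FluidPDE.oseenDuhamel 1 s (fun τ y => v τ (y + D)) (fun τ y => v τ (y + D)) t x
    rw [heatExtension_comp_add_right_apply, oseenDuhamel_comp_add_right]
    exact hmild s t hst htT (x + D)

/-- Conjugation `v ↦ R⁻¹ ∘ v τ ∘ R` by a linear isometry `R` of `ℝ³` preserves the honest class. -/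
theorem IsGenuine.symm_conj {T : ℝ} {v : ℝ → E3 → E3} (hv : IsGenuine T v) (R : E3 ≃ₗᵢ[ℝ] E3) :
    IsGenuine T fun τ y => R.symm (v τ (R y)) := by
  obtain ⟨hm, hc, ⟨K, hK⟩, hdiv, hmild⟩ := hv
  refine ⟨?_, ?_, ⟨K, fun t ht x => ?_⟩, fun t ht => ?_, ?_⟩
  · have e : uncurry (fun τ y => R.symm (v τ (R y))) =
        (fun z => R.symm z) ∘ uncurry v ∘ fun p : ℝ × E3 => (p.1, R p.2) := by
      funext p; rfl
    rw [e]
    exact R.symm.continuous.measurable.comp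
      (hm.comp (measurable_fst.prodMk (R.continuous.measurable.comp measurable_snd)))
  · have e : uncurry (fun τ y => R.symm (v τ (R y))) =
        (fun z => R.symm z) ∘ uncurry v ∘ fun p : ℝ × E3 => (p.1, R p.2) := by
      funext p; rfl
    rw [e]
    refine R.symm.continuous.comp_continuousOn
      (hc.comp (continuous_fst.prodMk (R.continuous.comp continuous_snd)).continuousOn ?_)
    intro p hp
    exact ⟨hp.1, mem_univ _⟩
  · rw [LinearIsometryEquiv.norm_map]
    exact hK t ht (R x)
  · simpa using IsWeaklyDivFree.conj_linearIsometryEquiv R.symm (hdiv t ht)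
  · intro s t hst htT x
    show R.symm (v t (R x)) = UnboundedOperators.heatExtension (fun y => R.symm (v s (R y))) (t - s) x -
      FluidPDE.oseenDuhamel 1 s (fun τ y => R.symm (v τ (R y))) (fun τ y => R.symm (v τ (R y))) t x
    rw [oseenDuhamel_symm_conj_linearIsometryEquiv R]
    have e : (fun y => R.symm (v s (R y))) = fun y => R.symm (v s (R.symm.symm y)) := by
      simp
    rw [e, heatExtension_conj_linearIsometryEquiv, LinearIsometryEquiv.symm_symm,
      hmild s t hst htT (R x), map_sub]

/-- **O3a is a theorem.** -/
theorem isometryCovariance_holds : IsometryCovariance := by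
  intro T v θ D hv
  exact (hv.comp_add_right D).symm_conj (rotZLIE θ)

/-! ## §3d  O4 is a theorem — and more: ONE horizontal direction of invariance suffices, no period needed
(the tree's line-invariant Liouville theorem = KNSS 2009 Thm 5.1 + §4 + Lemma 2.1, PROVED in
`Literature.Analysis.FluidPDE.KNSSLineInvariantLiouville`: a jointly continuous bounded ancient mild solution
invariant along a direction `e ≠ 0` is constant in space on every slice; the honest class maps into the duality
class by `Theorems.HardyAncientLimit.isBoundedAncientMildSolution_of_oseen`). -/

/-- **The honest class sits inside the duality class** (Oseen-mild continuous bounded ⇒ mild in the duality sense). -/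
theorem IsGenuine.isBoundedAncientMildSolution {v : ℝ → E3 → E3} (hv : IsGenuine 0 v) :
    FluidPDE.IsBoundedAncientMildSolution 1 v := by
  obtain ⟨_, hc, ⟨K, hK⟩, hdiv, hmild⟩ := hv
  have hK0 : 0 ≤ K := (norm_nonneg _).trans (hK (-1) (by norm_num) 0)
  exact Summit.NavierStokesRegularity.NavierStokesRegularity.Theorems.HardyAncientLimit.isBoundedAncientMildSolution_of_oseen
    hc hK0 hK hdiv hmild

/-- **Directional Liouville in the honest class**: an honest field on `(−∞,0)` invariant along ONE direction
`e ≠ 0` is constant in space on every slice (KNSS 2009 Thm 5.1 through the tree). -/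
theorem IsGenuine.eq_of_invariant_along {v : ℝ → E3 → E3} (hv : IsGenuine 0 v) {e : E3} (he : e ≠ 0)
    (hinv : ∀ t < 0, ∀ (x : E3) (δ : ℝ), v t (x + δ • e) = v t x) :
    ∀ τ < 0, ∀ y, v τ y = v τ 0 :=
  FluidPDE.apply_eq_apply_zero_of_invariant_along he hv.isBoundedAncientMildSolution hv.2.1 hinv

end Summit.NavierStokesRegularity.NavierStokesRegularity.Theorems.ScenarioCensus.RowA8HonestCell
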